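import Summits.QuantumFields.YangMills.Theorems.OnsetSkewLawRPOnsetFloorPosTimeSynthProfiles
import HarnessLib

/-!
# Tools for the positive-time Whitney-type synthesis (stub `stub_positiveTimeSynthesisCollar` of LINES
# «FloorInheritance» v5 / «MarkovFloorInheritance» v3, ym-idea-11, cruxes 23138 / 22956)

Mathlib-only tools on `ℝ⁴ = EuclideanSpace ℝ (Fin 4)`:
* §A norm bookkeeping (`‖w‖ ≤ 2 max|w_i|`, `∏_i (1+|c_i|)³ ≤ (1+‖c‖)¹⁴`);
* §B pull-back of uniform derivative bounds along affine maps (`‖D^i (f (L· − a))‖ ≤ D ‖L‖^i`);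
* §C the dyadic layers of `…PosTimeSynthProfiles` read on `ℝ⁴` through the time coordinate `timeCLM`, with uniform
  derivative bounds `‖D^i (z ↦ layer j (z 0))‖ ≤ Lb i (2^(j+2))^i`;
* §D the MASS BOOKKEEPING of the Whitney cover: `∑_{m} 1/(1+δ|m+1|)³ ≤ 3/δ` over any finite set of integers (telescoping),
  its four-dimensional product form `≤ (3/δ)⁴`, and the dyadic total `∑_{(j,n)} δ_j⁵ ∏_i 1/(1+δ_j|n_i+1|)³ ≤ 81/32`
  (`δ_j = 1/(64·2^j)`): five orders of flatness at the mirror pay for the `δ_j⁻⁴` pieces per layer.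

HONEST FRAMING: calculus infrastructure; no stub / crux / rung / summit is proved here; the Yang–Mills mass gap is NOT proved.
Cell `ym-idea-1`, width seat `ym-line-sfw-p2-w4` g21 (free hands). [folklore]
-/

set_option autoImplicit false

noncomputable section

open scoped BigOperators ContDiff
open Set

namespace Summit.QuantumFields.YangMills.Theorems.RPOnsetFloorPosTimeSynth

/-! ## §A Norm bookkeeping on `ℝ⁴` -/

/-- On `ℝ⁴ = EuclideanSpace ℝ (Fin 4)`: if every coordinate is at most `M` in absolute value then `‖w‖ ≤ 2M`. [folklore] -/
theorem norm_le_two_mul_of_abs_le (w : EuclideanSpace ℝ (Fin 4)) {M : ℝ} (hM : 0 ≤ M)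
    (h : ∀ i, |w i| ≤ M) : ‖w‖ ≤ 2 * M := by
  rw [EuclideanSpace.norm_eq]
  have hsum : ∑ i : Fin 4, ‖w i‖ ^ 2 ≤ 4 * M ^ 2 := by
    calc ∑ i : Fin 4, ‖w i‖ ^ 2 ≤ ∑ _i : Fin 4, M ^ 2 := Finset.sum_le_sum fun i _ => by
            rw [Real.norm_eq_abs]; exact pow_le_pow_left₀ (abs_nonneg _) (h i) 2
      _ = 4 * M ^ 2 := by simp
  calc Real.sqrt (∑ i : Fin 4, ‖w i‖ ^ 2) ≤ Real.sqrt (4 * M ^ 2) := Real.sqrt_le_sqrt hsum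
    _ = 2 * M := by
      rw [show (4 : ℝ) * M ^ 2 = (2 * M) ^ 2 by ring, Real.sqrt_sq (by positivity)]

/-- On `ℝ⁴`: `∏_i (1 + |c_i|)³ ≤ (1 + ‖c‖)¹⁴` (each `|c_i| ≤ ‖c‖`, and `(1 + ‖c‖)¹² ≤ (1 + ‖c‖)¹⁴`). [folklore] -/
theorem prod_one_add_abs_pow_le (c : EuclideanSpace ℝ (Fin 4)) : ∏ i, (1 + |c i|) ^ 3 ≤ (1 + ‖c‖) ^ 14 := by
  have h1 : ∀ i, (1 + |c i|) ^ 3 ≤ (1 + ‖c‖) ^ 3 := fun i =>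
    pow_le_pow_left₀ (by positivity) (by
      have := PiLp.norm_apply_le c i; rw [Real.norm_eq_abs] at this; linarith) 3
  calc ∏ i, (1 + |c i|) ^ 3 ≤ ∏ _i : Fin 4, (1 + ‖c‖) ^ 3 :=
        Finset.prod_le_prod (fun i _ => by positivity) fun i _ => h1 i
    _ = (1 + ‖c‖) ^ 12 := by rw [Finset.prod_const, Finset.card_univ, Fintype.card_fin, ← pow_mul]
    _ ≤ (1 + ‖c‖) ^ 14 := pow_le_pow_right₀ (by linarith [norm_nonneg c]) (by norm_num)

/-! ## §B Pull-back of uniform derivative bounds along affine maps -/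

/-- If `‖D^i f‖ ≤ D` everywhere then `‖D^i (f (L · - a))‖ ≤ D ‖L‖^i` for a continuous linear `L`. [folklore] -/
theorem norm_iteratedFDeriv_comp_affine_le {E G : Type*} [NormedAddCommGroup E] [NormedSpace ℝ E]
    [NormedAddCommGroup G] [NormedSpace ℝ G] {f : G → ℝ} (hf : ContDiff ℝ ∞ f) (L : E →L[ℝ] G) (a : G)
    {i : ℕ} {D : ℝ} (hD : ∀ y, ‖iteratedFDeriv ℝ i f y‖ ≤ D) (z : E) :
    ‖iteratedFDeriv ℝ i (fun z => f (L z - a)) z‖ ≤ D * ‖L‖ ^ i := by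
  have hfa : ContDiff ℝ ∞ (fun y => f (y - a)) := hf.comp (contDiff_id.sub contDiff_const)
  have hcomp : (fun z => f (L z - a)) = (fun y => f (y - a)) ∘ L := rfl
  rw [hcomp, L.iteratedFDeriv_comp_right hfa z (mod_cast le_top)]
  calc ‖(iteratedFDeriv ℝ i (fun y => f (y - a)) (L z)).compContinuousLinearMap fun _ => L‖
      ≤ ‖iteratedFDeriv ℝ i (fun y => f (y - a)) (L z)‖ * ∏ _i : Fin i, ‖L‖ :=
        ContinuousMultilinearMap.norm_compContinuousLinearMap_le _ _
    _ = ‖iteratedFDeriv ℝ i f (L z - a)‖ * ‖L‖ ^ i := by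
        rw [iteratedFDeriv_comp_sub, Finset.prod_const, Finset.card_univ, Fintype.card_fin]
    _ ≤ D * ‖L‖ ^ i := mul_le_mul_of_nonneg_right (hD _) (by positivity)

/-! ## §C The layers read on `ℝ⁴` -/

/-- The time-coordinate functional `z ↦ z 0` on `ℝ⁴` as a continuous linear map. [folklore] -/
def timeCLM : EuclideanSpace ℝ (Fin 4) →L[ℝ] ℝ := PiLp.proj 2 (fun _ : Fin 4 => ℝ) 0

/-- `timeCLM z = z 0`. [folklore] -/
@[simp] theorem timeCLM_apply (z : EuclideanSpace ℝ (Fin 4)) : timeCLM z = z 0 := rfl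

/-- `‖timeCLM‖ ≤ 1`. [folklore] -/
theorem norm_timeCLM_le : ‖timeCLM‖ ≤ 1 :=
  ContinuousLinearMap.opNorm_le_bound _ zero_le_one fun z => by
    rw [timeCLM_apply, one_mul]; exact PiLp.norm_apply_le z 0

/-- Uniform derivative bounds for the layers read on `ℝ⁴`: `‖D^i (z ↦ layer j (z 0))‖ ≤ Lb i · (2^(j+2))^i` with
constants `Lb i ≥ 0` independent of `j` (from the bounds on `smoothTransition` and `‖2^(j+2) • timeCLM‖ ≤ 2^(j+2)`).
[folklore] -/
theorem exists_bound_iteratedFDeriv_layer : ∃ Lb : ℕ → ℝ, (∀ i, 0 ≤ Lb i) ∧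
    ∀ (j i : ℕ) (z : EuclideanSpace ℝ (Fin 4)),
      ‖iteratedFDeriv ℝ i (fun z : EuclideanSpace ℝ (Fin 4) => layer j (z 0)) z‖ ≤ Lb i * (2 ^ (j + 2)) ^ i := by
  choose D hD0 hD using exists_bound_iteratedFDeriv_smoothTransition
  have hcum : ∀ (j i : ℕ) (z : EuclideanSpace ℝ (Fin 4)),
      ‖iteratedFDeriv ℝ i (fun z : EuclideanSpace ℝ (Fin 4) => layerCum j (z 0)) z‖ ≤ D i * (2 ^ (j + 2)) ^ i := by
    intro j i z
    have hfun : (fun z : EuclideanSpace ℝ (Fin 4) => layerCum j (z 0)) =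
        fun z => Real.smoothTransition ((((2 : ℝ) ^ (j + 2)) • timeCLM) z - 2) := by
      funext z; simp [layerCum]
    rw [hfun]
    refine (norm_iteratedFDeriv_comp_affine_le Real.smoothTransition.contDiff _ _ (hD i) z).trans ?_
    refine mul_le_mul_of_nonneg_left ?_ (hD0 i)
    apply pow_le_pow_left₀ (norm_nonneg _)
    rw [norm_smul, Real.norm_of_nonneg (by positivity)]
    calc (2 : ℝ) ^ (j + 2) * ‖timeCLM‖ ≤ 2 ^ (j + 2) * 1 :=
          mul_le_mul_of_nonneg_left norm_timeCLM_le (by positivity)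
      _ = 2 ^ (j + 2) := mul_one _
  refine ⟨fun i => 2 * D i, fun i => by have := hD0 i; positivity, fun j i z => ?_⟩
  cases j with
  | zero =>
    have h := hcum 0 i z
    have : (fun z : EuclideanSpace ℝ (Fin 4) => layer 0 (z 0)) = fun z => layerCum 0 (z 0) := rfl
    rw [this]
    calc _ ≤ D i * (2 ^ (0 + 2)) ^ i := h
      _ ≤ 2 * D i * (2 ^ (0 + 2)) ^ i := by
          have := hD0 i; nlinarith [pow_nonneg (show (0:ℝ) ≤ 2 ^ (0 + 2) by positivity) i]
  | succ j =>
    have hf1 : ContDiff ℝ i (fun z : EuclideanSpace ℝ (Fin 4) => layerCum (j + 1) (z 0)) :=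
      ((layerCum_contDiff (j + 1)).of_le (mod_cast le_top)).comp (contDiff_piLp_apply (p := 2))
    have hf0 : ContDiff ℝ i (fun z : EuclideanSpace ℝ (Fin 4) => layerCum j (z 0)) :=
      ((layerCum_contDiff j).of_le (mod_cast le_top)).comp (contDiff_piLp_apply (p := 2))
    have : (fun z : EuclideanSpace ℝ (Fin 4) => layer (j + 1) (z 0)) =
        fun z => layerCum (j + 1) (z 0) - layerCum j (z 0) := rfl
    rw [this, fun_iteratedFDeriv_sub_apply hf1.contDiffAt hf0.contDiffAt]
    have hp : ((2 : ℝ) ^ (j + 2)) ^ i ≤ (2 ^ (j + 1 + 2)) ^ i :=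
      pow_le_pow_left₀ (by positivity) (pow_le_pow_right₀ (by norm_num) (by omega)) i
    calc ‖iteratedFDeriv ℝ i (fun z : EuclideanSpace ℝ (Fin 4) => layerCum (j + 1) (z 0)) z -
            iteratedFDeriv ℝ i (fun z : EuclideanSpace ℝ (Fin 4) => layerCum j (z 0)) z‖
        ≤ ‖iteratedFDeriv ℝ i (fun z : EuclideanSpace ℝ (Fin 4) => layerCum (j + 1) (z 0)) z‖ +
            ‖iteratedFDeriv ℝ i (fun z : EuclideanSpace ℝ (Fin 4) => layerCum j (z 0)) z‖ := norm_sub_le _ _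
      _ ≤ D i * (2 ^ (j + 1 + 2)) ^ i + D i * (2 ^ (j + 2)) ^ i := add_le_add (hcum _ i z) (hcum _ i z)
      _ ≤ D i * (2 ^ (j + 1 + 2)) ^ i + D i * (2 ^ (j + 1 + 2)) ^ i := by
          have := mul_le_mul_of_nonneg_left hp (hD0 i); linarith
      _ = 2 * D i * (2 ^ (j + 1 + 2)) ^ i := by ring

/-! ## §D Lattice sums: the mass bookkeeping of the Whitney cover -/

/-- Telescoping comparison: `1/(1+δ(k+1))³ ≤ δ⁻¹ (1/(1+δk)² − 1/(1+δ(k+1))²)` for `δ > 0`, `k ≥ 0`. [folklore] -/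
theorem inv_cube_le_telescope {δ k : ℝ} (hδ : 0 < δ) (hk : 0 ≤ k) :
    ((1 + δ * (k + 1)) ^ 3)⁻¹ ≤ δ⁻¹ * (((1 + δ * k) ^ 2)⁻¹ - ((1 + δ * (k + 1)) ^ 2)⁻¹) := by
  set a : ℝ := 1 + δ * k with ha
  have hb : 1 + δ * (k + 1) = a + δ := by rw [ha]; ring
  rw [hb]
  have ha1 : 1 ≤ a := by rw [ha]; nlinarith
  have hab : 0 < a + δ := by linarith
  rw [← sub_nonneg]
  have e : δ⁻¹ * ((a ^ 2)⁻¹ - ((a + δ) ^ 2)⁻¹) - ((a + δ) ^ 3)⁻¹ =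
      (a * (a + δ) + (a + δ) ^ 2 - a ^ 2 - a ^ 2 * 0) / (a ^ 2 * (a + δ) ^ 3) := by
    field_simp; ring
  rw [e]
  apply div_nonneg _ (by positivity)
  nlinarith

/-- Symmetric lattice sum: `∑_{|k| ≤ R} 1/(1+δ|k|)³ ≤ 1 + 2/δ` for `0 < δ`. [folklore] -/
theorem sum_Icc_inv_cube_le {δ : ℝ} (hδ : 0 < δ) (R : ℕ) :
    ∑ k ∈ Finset.Icc (-(R : ℤ)) R, ((1 + δ * |(k : ℝ)|) ^ 3)⁻¹ ≤ 1 + 2 / δ := by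
  -- stronger telescoped statement
  suffices h : ∑ k ∈ Finset.Icc (-(R : ℤ)) R, ((1 + δ * |(k : ℝ)|) ^ 3)⁻¹ ≤
      1 + 2 * (δ⁻¹ * (1 - ((1 + δ * R) ^ 2)⁻¹)) by
    refine h.trans ?_
    rw [div_eq_mul_inv]
    have : 0 ≤ ((1 + δ * (R : ℝ)) ^ 2)⁻¹ := by positivity
    nlinarith [inv_pos.2 hδ]
  induction R with
  | zero => simp
  | succ R ih =>
    have hdecomp : Finset.Icc (-((R + 1 : ℕ) : ℤ)) ((R + 1 : ℕ) : ℤ) =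
        insert (-((R : ℤ) + 1)) (insert ((R : ℤ) + 1) (Finset.Icc (-(R : ℤ)) R)) := by
      ext k; simp only [Finset.mem_Icc, Finset.mem_insert, Nat.cast_succ]; omega
    have h1 : ((R : ℤ) + 1) ∉ Finset.Icc (-(R : ℤ)) R := by simp
    have h2 : (-((R : ℤ) + 1)) ∉ insert ((R : ℤ) + 1) (Finset.Icc (-(R : ℤ)) R) := by
      simp only [Finset.mem_insert, Finset.mem_Icc]; omega
    rw [hdecomp, Finset.sum_insert h2, Finset.sum_insert h1]
    have hcast1 : |(((R : ℤ) + 1 : ℤ) : ℝ)| = (R : ℝ) + 1 := by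
      push_cast; exact abs_of_nonneg (by positivity)
    have hcast2 : |((-((R : ℤ) + 1) : ℤ) : ℝ)| = (R : ℝ) + 1 := by
      push_cast; rw [abs_neg]; exact abs_of_nonneg (by positivity)
    rw [hcast1, hcast2]
    have ht := inv_cube_le_telescope hδ (Nat.cast_nonneg R)
    push_cast
    nlinarith [ht, ih]

/-- Any finite lattice sum: `∑_{m ∈ t} 1/(1+δ|m+1|)³ ≤ 3/δ` for `0 < δ ≤ 1` and every finite `t ⊆ ℤ`. [folklore] -/
theorem sum_inv_cube_le {δ : ℝ} (hδ : 0 < δ) (hδ1 : δ ≤ 1) (t : Finset ℤ) :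
    ∑ m ∈ t, ((1 + δ * |(m : ℝ) + 1|) ^ 3)⁻¹ ≤ 3 / δ := by
  -- shift `k = m + 1`
  have hshift : ∑ m ∈ t, ((1 + δ * |(m : ℝ) + 1|) ^ 3)⁻¹ =
      ∑ k ∈ t.map (addRightEmbedding (1 : ℤ)), ((1 + δ * |(k : ℝ)|) ^ 3)⁻¹ := by
    rw [Finset.sum_map]; simp
  rw [hshift]
  set t' := t.map (addRightEmbedding (1 : ℤ)) with ht'
  -- enclose in a symmetric interval
  set R : ℕ := t'.sup fun k => k.natAbs with hR
  have hsub : t' ⊆ Finset.Icc (-(R : ℤ)) R := by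
    intro k hk
    have hk' : k.natAbs ≤ R := Finset.le_sup (f := fun k : ℤ => k.natAbs) hk
    simp only [Finset.mem_Icc]; omega
  calc ∑ k ∈ t', ((1 + δ * |(k : ℝ)|) ^ 3)⁻¹ ≤ ∑ k ∈ Finset.Icc (-(R : ℤ)) R, ((1 + δ * |(k : ℝ)|) ^ 3)⁻¹ :=
        Finset.sum_le_sum_of_subset_of_nonneg hsub fun k _ _ => by positivity
    _ ≤ 1 + 2 / δ := sum_Icc_inv_cube_le hδ R
    _ ≤ 3 / δ := by
        have : (1 : ℝ) ≤ 1 / δ := by rw [le_div_iff₀ hδ]; linarith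
        have e : (3 : ℝ) / δ = 1 / δ + 2 / δ := by ring
        rw [e]; linarith

/-- The four-dimensional lattice sum factorises: `∑_{n ∈ s} ∏_i 1/(1+δ|n_i+1|)³ ≤ (3/δ)⁴` for every finite `s ⊆ ℤ⁴`.
[folklore] -/
theorem sum_prod_inv_cube_le {δ : ℝ} (hδ : 0 < δ) (hδ1 : δ ≤ 1) (s : Finset (Fin 4 → ℤ)) :
    ∑ n ∈ s, ∏ i, ((1 + δ * |((n i : ℤ) : ℝ) + 1|) ^ 3)⁻¹ ≤ (3 / δ) ^ 4 := by
  set T : Fin 4 → Finset ℤ := fun i => s.image fun n => n i with hT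
  have hsub : s ⊆ Fintype.piFinset T := by
    intro n hn
    rw [Fintype.mem_piFinset]
    exact fun i => Finset.mem_image_of_mem _ hn
  calc ∑ n ∈ s, ∏ i, ((1 + δ * |((n i : ℤ) : ℝ) + 1|) ^ 3)⁻¹
      ≤ ∑ n ∈ Fintype.piFinset T, ∏ i, ((1 + δ * |((n i : ℤ) : ℝ) + 1|) ^ 3)⁻¹ :=
        Finset.sum_le_sum_of_subset_of_nonneg hsub fun n _ _ => Finset.prod_nonneg fun i _ => by positivity
    _ = ∏ i : Fin 4, ∑ m ∈ T i, ((1 + δ * |((m : ℤ) : ℝ) + 1|) ^ 3)⁻¹ :=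
        (Finset.prod_univ_sum T (fun _ (m : ℤ) => ((1 + δ * |((m : ℤ) : ℝ) + 1|) ^ 3)⁻¹)).symm
    _ ≤ ∏ _i : Fin 4, (3 / δ) :=
        Finset.prod_le_prod (fun i _ => Finset.sum_nonneg fun m _ => by positivity)
          fun i _ => sum_inv_cube_le hδ hδ1 (T i)
    _ = (3 / δ) ^ 4 := by rw [Finset.prod_const, Finset.card_univ, Fintype.card_fin]

/-- **Mass bookkeeping of the Whitney cover.**  With `δ_j = 1/(64·2^j)`, the weights
`δ_j⁵ ∏_i 1/(1+δ_j|n_i+1|)³` have all finite partial sums over `(j,n) ∈ ℕ × ℤ⁴` bounded by `81/32`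
(`∑_n ≤ (3/δ_j)⁴ = 81 δ_j⁻⁴`, `∑_j δ_j = (1/64)·∑ 2^(−j) ≤ 1/32`). [folklore] -/
theorem sum_dyadic_weight_le (u : Finset (ℕ × (Fin 4 → ℤ))) :
    ∑ p ∈ u, ((64 : ℝ) * 2 ^ p.1)⁻¹ ^ 5 * ∏ i, ((1 + ((64 : ℝ) * 2 ^ p.1)⁻¹ * |((p.2 i : ℤ) : ℝ) + 1|) ^ 3)⁻¹ ≤
      81 / 32 := by
  have hδ : ∀ j : ℕ, 0 < ((64 : ℝ) * 2 ^ j)⁻¹ := fun j => by positivity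
  have hδ1 : ∀ j : ℕ, ((64 : ℝ) * 2 ^ j)⁻¹ ≤ 1 := fun j => by
    apply inv_le_one_of_one_le₀
    have : (1 : ℝ) ≤ 2 ^ j := one_le_pow₀ (by norm_num)
    linarith
  set J := u.image Prod.fst with hJ
  set S := u.image Prod.snd with hS
  have hsub : u ⊆ J ×ˢ S := fun p hp =>
    Finset.mem_product.2 ⟨Finset.mem_image_of_mem _ hp, Finset.mem_image_of_mem _ hp⟩
  have hnonneg : ∀ p : ℕ × (Fin 4 → ℤ), 0 ≤ ((64 : ℝ) * 2 ^ p.1)⁻¹ ^ 5 *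
      ∏ i, ((1 + ((64 : ℝ) * 2 ^ p.1)⁻¹ * |((p.2 i : ℤ) : ℝ) + 1|) ^ 3)⁻¹ := fun p =>
    mul_nonneg (pow_nonneg (hδ p.1).le 5) (Finset.prod_nonneg fun i _ => by positivity)
  calc ∑ p ∈ u, ((64 : ℝ) * 2 ^ p.1)⁻¹ ^ 5 * ∏ i, ((1 + ((64 : ℝ) * 2 ^ p.1)⁻¹ * |((p.2 i : ℤ) : ℝ) + 1|) ^ 3)⁻¹
      ≤ ∑ p ∈ J ×ˢ S, ((64 : ℝ) * 2 ^ p.1)⁻¹ ^ 5 *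
          ∏ i, ((1 + ((64 : ℝ) * 2 ^ p.1)⁻¹ * |((p.2 i : ℤ) : ℝ) + 1|) ^ 3)⁻¹ :=
        Finset.sum_le_sum_of_subset_of_nonneg hsub fun p _ _ => hnonneg p
    _ = ∑ j ∈ J, ((64 : ℝ) * 2 ^ j)⁻¹ ^ 5 *
          ∑ n ∈ S, ∏ i, ((1 + ((64 : ℝ) * 2 ^ j)⁻¹ * |((n i : ℤ) : ℝ) + 1|) ^ 3)⁻¹ := by
        rw [Finset.sum_product]; simp only [Finset.mul_sum]
    _ ≤ ∑ j ∈ J, ((64 : ℝ) * 2 ^ j)⁻¹ ^ 5 * (3 / ((64 : ℝ) * 2 ^ j)⁻¹) ^ 4 :=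
        Finset.sum_le_sum fun j _ => mul_le_mul_of_nonneg_left (sum_prod_inv_cube_le (hδ j) (hδ1 j) S)
          (pow_nonneg (hδ j).le 5)
    _ = ∑ j ∈ J, (81 / 64) * (1 / 2) ^ j := Finset.sum_congr rfl fun j _ => by
        have h2 : (2 : ℝ) ^ j ≠ 0 := pow_ne_zero _ two_ne_zero
        have hx : (0 : ℝ) < 2 ^ j := by positivity
        have e1 : ((64 : ℝ) * 2 ^ j)⁻¹ ^ 5 * (3 / ((64 : ℝ) * 2 ^ j)⁻¹) ^ 4 = 81 / (64 * 2 ^ j) := by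
          rw [div_inv_eq_mul, mul_pow, show (5 : ℕ) = 1 + 4 by norm_num, pow_add, pow_one]
          have hne : ((64 : ℝ) * 2 ^ j) ≠ 0 := by positivity
          have : ((64 : ℝ) * 2 ^ j)⁻¹ ^ 4 * ((64 : ℝ) * 2 ^ j) ^ 4 = 1 := by
            rw [← mul_pow, inv_mul_cancel₀ hne, one_pow]
          calc ((64 : ℝ) * 2 ^ j)⁻¹ * ((64 : ℝ) * 2 ^ j)⁻¹ ^ 4 * ((3 : ℝ) ^ 4 * ((64 : ℝ) * 2 ^ j) ^ 4)
              = ((64 : ℝ) * 2 ^ j)⁻¹ * 3 ^ 4 * (((64 : ℝ) * 2 ^ j)⁻¹ ^ 4 * ((64 : ℝ) * 2 ^ j) ^ 4) := by ring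
            _ = 81 / (64 * 2 ^ j) := by rw [this, mul_one, mul_comm, ← div_eq_mul_inv]; norm_num
        rw [e1, one_div_pow, div_mul_div_comm, mul_one]
    _ = (81 / 64) * ∑ j ∈ J, (1 / 2 : ℝ) ^ j := by rw [Finset.mul_sum]
    _ ≤ (81 / 64) * 2 := by
        refine mul_le_mul_of_nonneg_left ?_ (by norm_num)
        have hJsub : J ⊆ Finset.range (J.sup id + 1) := fun j hj =>
          Finset.mem_range.2 (Nat.lt_succ_of_le (Finset.le_sup (f := id) hj))
        exact (Finset.sum_le_sum_of_subset_of_nonneg hJsub fun j _ _ => by positivity).trans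
          (sum_geometric_two_le _)
    _ = 81 / 32 := by norm_num

end Summit.QuantumFields.YangMills.Theorems.RPOnsetFloorPosTimeSynth

end
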